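import Summits.BirchSwinnertonDyer.Rank1Residual.Additive.TameBranchLower
import Summits.BirchSwinnertonDyer.Rank1Residual.Additive.GordCharLeadingTermConsequences
import Summits.BirchSwinnertonDyer.Rank1Residual.Additive.GordThreeCycLowerCore
import HarnessLib

/-!
# Class wrappers over cc-typer-2's `TameBranchLower.lean` on the (G)-ordinary cell: N10's D-ii corner
# (`e ∈ {3,4,6}`, `p ≥ 5`), D-i (`e = 2`, `p ≥ 5`) and N11's (G-ord)@3 — the tame-branch rational main
# conjecture + ONE unit coefficient ⟹ the LOWER half / `BSD(E,p)` through Delbourgo 2002 Thm. (A)+(B)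
# (A175 at `p ≥ 5`, `mainTheorem_three` at `p = 3`), with NO `ExactLeadingTermAt` binder
# (cell `b2b-bsdres`, team n1011, seat p16 GEN 2; lead ruling R5-3 / R5-12(b))

HONEST FRAMING (cell `b2b-bsdres`, run/shared/lean/b2b/bsd-rank1-residual/, verbatim in every
file): the goal of the cell is to DELETE the COMBINATION-SHAPED residual classes of the
Birch–Swinnerton-Dyer formula for ALL analytic-rank `≤ 1` elliptic curves over `ℚ` — "full BSD
formula for every rank `≤ 1` curve in class `C`" assembled STRICTLY from published theorems — so
that the rank-`≤ 1` remainder becomes exactly the CONSTRUCTION-SHAPED classes, which are TYPED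
(missing-input `Prop`s), NOT attempted. This is not "finishing BSD". Team n1011 (N10 / N11), seat
p16: research route; X3♯(G-ord) / X4♯(G-ord) and the N10 / N11 marks are UNCHANGED by this file;
nothing is booked here.

Theorems only (no `def`, no `sorry`, no new named fact); every input consumed BY NAME. cc-typer-2's
`TameBranchLower.lean` (p252761) types the tame-branch cyclotomic main conjecture of `E` at an additive
potentially-ordinary `p` as a RATIONAL equality `TameBranchRatCharEqAt W p` in E-intrinsic currency and
proves `cycLeadingTermDvdAt_of_tameBranchRatCharEq_of_unitCoeff`: the conjecture + the E-normalised
tame-branch tuple `(f, ε, α, B)` (`IsTameBranchOf`) + ONE unit coefficient of `B` (`μ = 0`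
certificate) + the `T = 0` period binder `α⁻¹·[0]⁺_f = z₀·(L(E,1)/Ω_E)` ⟹ n1011-p18's
`CycLeadingTermDvdAt W p`; its own class forms then need the second typed input `ExactLeadingTermAt W p`.
THIS file routes the same `T = 0` output through Delbourgo 2002 Thm. (A)+(B) instead (additive-p2's /
p16's chains over the named facts A175 `Delbourgo2002.mainTheorem` (`p ≥ 5`) and
`Delbourgo2002.mainTheorem_three` (`p = 3`)), which is EXACT off the anomalous rows
(`Delbourgo2002.ReductionNonAnomalous W p`) and carries the slack `ℓ ∣ p²` on them:

* §1 `TypeGOrd.cycLowerLeadingTermAt_of_tameBranchRatCharEq_of_unitCoeff` (any odd `p`): the tame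
  inputs ⟹ the decl of record `CycLowerLeadingTermAt W p` (cc-typer-2 ⟹ p18's `CycLeadingTermDvdAt` ⟹
  `N10.cycLowerLeadingTermAt_of_cycLeadingTermDvdAt`);
* §2 `p ≥ 5`, X4♯(G-ord) / X3♯(G-ord), EVERY defect `e ∈ {2,3,4,6}` (N10 D-i ∪ D-ii), `r_an = 0`,
  non-CM: `ClassX4Gord.missingLowerBoundAt_rankZero_of_tameBranchRatCharEq_of_unitCoeff_of_nonAnomalous`
  (LOWER half off the anomalous rows), `…padicValRat_shaAn_le_add_two_…` (slack `≤ 2` on every row),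
  `ClassX4Gord.bsdp_rankZero_of_tameBranchRatCharEq_of_unitCoeff_of_cycLeadingTerm_of_nonAnomalous`
  (**D-ii corner**: `BSD(E,p)` ⟸ tame inputs + the typed UPPER input `CycLeadingTermAt W p` of
  `GordCycLeadingTerm.lean`), `ClassX4Gord.bsdp_rankZero_of_tameBranchRatCharEq_of_unitCoeff_of_surj_of_nonAnomalous`
  (**D-i, `e = 2` ∧ surj**: the UPPER half is the Kato-component THEOREM, `…_of_katoComponent`), and the
  X3 twins (`ClassX3Gord.…`, Wuthrich component on `e = 2`);
* §3 `p = 3`, (G-ord)@3 = N11's GordTwo-ord rows (`e = 2` automatic): `ClassX4Gord.missingLowerBoundAt_three_rankZero_of_tameBranchRatCharEq_of_unitCoeff_of_nonAnomalous`,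
  `ClassX4Gord.bsdp_three_rankZero_of_tameBranchRatCharEq_of_unitCoeff_of_nonAnomalous_of_surj`,
  `TypeGOrd.padicValRat_shaAn_le_add_two_three_of_tameBranchRatCharEq_of_unitCoeff` (anomalous rows:
  slack `≤ 2` — the EXACT alternative on those rows is the `K`-side route of
  `XGordRankZeroCyclotomicThreeLower[Facts].lean`, a different input currency), and the X3 twins.

The conjecture, the tuple and the certificate remain explicit per-pair binders exactly as in
cc-typer-2's file (vacuity prerequisite NAMED there, not minted); nothing here asserts them. Census
pointers: N10 D-ii 4 073 cells / D-i / (G-ord)@3 4 225 r0 cells (p14 tb1; anomalous share at 3: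
`HOME/b2b-bsdres-n1011-p16/g2/CENSUS-GK3LOW.md`).
-/

noncomputable section

open scoped Classical MatrixGroups ModularForm NumberField

open CongruenceSubgroup WeierstrassCurve NumberField Literature.NumberTheory.EllipticCurves
  Literature.NumberTheory.EllipticCurves.ModularForms
  Literature.NumberTheory.EllipticCurves.Rank1Residual
  Literature.NumberTheory.EllipticCurves.Rank1Residual.Typed
  IsDedekindDomain

namespace Summit.BirchSwinnertonDyer.Rank1Residual.Additive

/-! ### §1 The tame inputs give the decl of record `CycLowerLeadingTermAt` (any odd `p`) -/

section AnyOddPrime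

variable (W : WeierstrassCurve ℚ) [W.IsElliptic] [W.IsGloballyMinimal] (p : ℕ) [hp : Fact p.Prime]

/-- **(G-ord), any odd `p`, any defect: the tame-branch rational main conjecture + ONE unit coefficient
+ the `T = 0` period binder ⟹ `CycLowerLeadingTermAt W p`** (cc-typer-2's
`cycLeadingTermDvdAt_of_tameBranchRatCharEq_of_unitCoeff` followed by
`N10.cycLowerLeadingTermAt_of_cycLeadingTermDvdAt`). [cite: MazurTateTeitelbaum1986Invent, §I.14]
[cite: Delbourgo1998, Main Conjecture (p. 151) (shape)] -/
theorem TypeGOrd.cycLowerLeadingTermAt_of_tameBranchRatCharEq_of_unitCoeff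
    (hp2 : p ≠ 2) (hadd : Addv W p) (hG : TypeGOrd W p)
    (hT : TameBranchRatCharEqAt W p)
    {N : ℕ} [NeZero N] {f : CuspForm (Gamma0 N) 2} {ε : DirichletCharacter ℂ_[p] p} {α : ℚ_[p]}
    {B : PowerSeries ℚ_[p]}
    (hf : IsNewformOf W f) (hε : orderOf ε = tameDefect W p) (hα : ‖α‖ = 1)
    (hB : IsTameBranchOf f p ε α B) (hcert : ∃ n : ℕ, ‖PowerSeries.coeff n B‖ = 1)
    {q : ℚ} (hq : W.entireLFunction 1 = (q : ℂ) * (W.realPeriodRat : ℂ))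
    {z₀ : ℤ_[p]} (h0 : α⁻¹ * (ratPlusSymbol f 0 : ℚ_[p]) = (z₀ : ℚ_[p]) * (q : ℚ_[p])) :
    CycLowerLeadingTermAt W p :=
  N10.cycLowerLeadingTermAt_of_cycLeadingTermDvdAt W p
    (cycLeadingTermDvdAt_of_tameBranchRatCharEq_of_unitCoeff W p hT hp2 hadd (Or.inr hG) hf hε hα hB hcert hq h0)

end AnyOddPrime

/-! ### §2 `p ≥ 5`: N10's D-i / D-ii rows over Delbourgo 2002 (A175) -/

section FiveLe

variable {W : WeierstrassCurve ℚ} [W.IsElliptic] [W.IsGloballyMinimal] {p : ℕ} [hp : Fact p.Prime]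

/-- **X4♯(G-ord), `p ≥ 5`, EVERY defect, `r_an = 0`, non-CM, OFF the anomalous rows: the LOWER half
`ord_p #Ш_an(E) ≤ ord_p #Ш(E)` from the tame inputs** through Delbourgo 2002 (A175, `hDel`; additive-p2's
`ClassX4Gord.missingLowerBoundAt_rankZero_of_cycLower_of_nonAnomalous`). No `ExactLeadingTermAt`.
[cite: Delbourgo2002, Theorem (A), (B) (p. 40)] [cite: Miller2011LMS, Def. 1.1] -/
theorem ClassX4Gord.missingLowerBoundAt_rankZero_of_tameBranchRatCharEq_of_unitCoeff_of_nonAnomalous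
    (hDel : Delbourgo2002.mainTheorem)
    (hGZK : rank_eq_analyticRank_of_analyticRank_le_one) (hmod : hasEntireLFunction_rat)
    (hX : ClassX4Gord W p) (hcm : ¬ W.HasCM) (hp5 : 5 ≤ p) (hr : W.analyticRank = 0)
    (hna : Delbourgo2002.ReductionNonAnomalous W p)
    (hT : TameBranchRatCharEqAt W p)
    {N : ℕ} [NeZero N] {f : CuspForm (Gamma0 N) 2} {ε : DirichletCharacter ℂ_[p] p} {α : ℚ_[p]}
    {B : PowerSeries ℚ_[p]}
    (hf : IsNewformOf W f) (hε : orderOf ε = tameDefect W p) (hα : ‖α‖ = 1)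
    (hB : IsTameBranchOf f p ε α B) (hcert : ∃ n : ℕ, ‖PowerSeries.coeff n B‖ = 1)
    {q : ℚ} (hq : W.entireLFunction 1 = (q : ℂ) * (W.realPeriodRat : ℂ))
    {z₀ : ℤ_[p]} (h0 : α⁻¹ * (ratPlusSymbol f 0 : ℚ_[p]) = (z₀ : ℚ_[p]) * (q : ℚ_[p])) :
    MissingLowerBoundAt W p :=
  ClassX4Gord.missingLowerBoundAt_rankZero_of_cycLower_of_nonAnomalous hDel hGZK hmod hX hcm hp5 hr
    (TypeGOrd.cycLowerLeadingTermAt_of_tameBranchRatCharEq_of_unitCoeff W p hX.1.1 hX.1.2.1 hX.2 hT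
      hf hε hα hB hcert hq h0) hna

/-- **(G-ord), `p ≥ 5`, EVERY row (anomalous included): `#Ш_an = q` with `ord_p q ≤ ord_p #Ш(E) + 2`
from the tame inputs** (the slack `ℓ ∣ p²` of Delbourgo 2002 Thm. (B); additive-p2's
`padicVal_shaAn_le_add_two_rankZero_of_cycLower`). [cite: Delbourgo2002, Theorem (B) (p. 40), ℓ_p(E) (p. 39)] -/
theorem TypeGOrd.padicValRat_shaAn_le_add_two_of_tameBranchRatCharEq_of_unitCoeff
    (hDel : Delbourgo2002.mainTheorem)
    (hGZK : rank_eq_analyticRank_of_analyticRank_le_one) (hmod : hasEntireLFunction_rat)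
    (hp5 : 5 ≤ p) (hcm : ¬ W.HasCM) (hadd : Addv W p) (hG : TypeGOrd W p) (hr : W.analyticRank = 0)
    (hT : TameBranchRatCharEqAt W p)
    {N : ℕ} [NeZero N] {f : CuspForm (Gamma0 N) 2} {ε : DirichletCharacter ℂ_[p] p} {α : ℚ_[p]}
    {B : PowerSeries ℚ_[p]}
    (hf : IsNewformOf W f) (hε : orderOf ε = tameDefect W p) (hα : ‖α‖ = 1)
    (hB : IsTameBranchOf f p ε α B) (hcert : ∃ n : ℕ, ‖PowerSeries.coeff n B‖ = 1)
    {q : ℚ} (hq : W.entireLFunction 1 = (q : ℂ) * (W.realPeriodRat : ℂ))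
    {z₀ : ℤ_[p]} (h0 : α⁻¹ * (ratPlusSymbol f 0 : ℚ_[p]) = (z₀ : ℚ_[p]) * (q : ℚ_[p])) :
    ∃ q : ℚ, shaAn W = (q : ℂ) ∧ padicValRat p q ≤ (padicValNat p W.shaOrder : ℤ) + 2 :=
  padicVal_shaAn_le_add_two_rankZero_of_cycLower W p hDel hGZK hmod hp5 hcm hadd hG hr
    (TypeGOrd.cycLowerLeadingTermAt_of_tameBranchRatCharEq_of_unitCoeff W p (by omega) hadd hG hT
      hf hε hα hB hcert hq h0)

/-- **N10's D-ii CORNER (X4♯(G-ord), `e ∈ {3,4,6}` — and `e = 2`), `p ≥ 5`, `r_an = 0`, non-CM,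
non-anomalous: `BSD(E,p)` ⟸ the tame inputs (LOWER) + the typed cyclotomic leading term
`CycLeadingTermAt W p` (UPPER)** — additive-p2's
`ClassX4Gord.bsdp_rankZero_of_cycLeadingTerm_of_cycLower_of_nonAnomalous` (Delbourgo 1998 Prop. 4 `hDel98`
+ Delbourgo 2002 `hDel`). X4♯(G-ord) stays CONSTRUCTION-SHAPED; nothing booked.
[cite: Delbourgo2002, Theorem (A), (B) (p. 40)] [cite: Delbourgo1998, Prop. 4 (p. 144)] -/
theorem ClassX4Gord.bsdp_rankZero_of_tameBranchRatCharEq_of_unitCoeff_of_cycLeadingTerm_of_nonAnomalous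
    (hDel98 : Delbourgo1998.prop4_rankZero_pow_dvd_constantCoeff) (hDel : Delbourgo2002.mainTheorem)
    (hGZK : rank_eq_analyticRank_of_analyticRank_le_one) (hmod : hasEntireLFunction_rat)
    (hX : ClassX4Gord W p) (hcm : ¬ W.HasCM) (hp5 : 5 ≤ p) (hr : W.analyticRank = 0)
    (hLT : CycLeadingTermAt W p) (hna : Delbourgo2002.ReductionNonAnomalous W p)
    (hT : TameBranchRatCharEqAt W p)
    {N : ℕ} [NeZero N] {f : CuspForm (Gamma0 N) 2} {ε : DirichletCharacter ℂ_[p] p} {α : ℚ_[p]}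
    {B : PowerSeries ℚ_[p]}
    (hf : IsNewformOf W f) (hε : orderOf ε = tameDefect W p) (hα : ‖α‖ = 1)
    (hB : IsTameBranchOf f p ε α B) (hcert : ∃ n : ℕ, ‖PowerSeries.coeff n B‖ = 1)
    {q : ℚ} (hq : W.entireLFunction 1 = (q : ℂ) * (W.realPeriodRat : ℂ))
    {z₀ : ℤ_[p]} (h0 : α⁻¹ * (ratPlusSymbol f 0 : ℚ_[p]) = (z₀ : ℚ_[p]) * (q : ℚ_[p])) : BSDp W p :=
  ClassX4Gord.bsdp_rankZero_of_cycLeadingTerm_of_cycLower_of_nonAnomalous hDel98 hDel hGZK hmod hX hcm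
    hp5 hr hLT
    (TypeGOrd.cycLowerLeadingTermAt_of_tameBranchRatCharEq_of_unitCoeff W p hX.1.1 hX.1.2.1 hX.2 hT
      hf hε hα hB hcert hq h0) hna

/-- **N10's D-i rows (X4♯(G-ord), `e = 2` ∧ `surj`), `p ≥ 5`, `r_an = 0`, non-CM, non-anomalous:
`BSD(E,p)` ⟸ the tame inputs ALONE** — the UPPER half is the Kato-component THEOREM
(`ClassX4Gord.bsdp_rankZero_of_cycLower_of_katoComponent`: Kato 17.4 (3) component `hKa`, Pal `hPal`,
Delbourgo `hDel98` / `hDel`, modularity, GZK). Nothing booked.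
[cite: Kato2004Asterisque, Thm. 17.4 (3) (p. 273)] [cite: Delbourgo2002, Theorem (A), (B) (p. 40)] -/
theorem ClassX4Gord.bsdp_rankZero_of_tameBranchRatCharEq_of_unitCoeff_of_surj_of_nonAnomalous
    (hKa : Kato2004.charIdeal_dvd_padicLFunctionBranch_component_of_surjective)
    (hPal : Pal2012.thm32_sqrt_mul_realPeriodRat_twist_eq_of_prime_one_mod_four)
    (hDel98 : Delbourgo1998.prop4_rankZero_pow_dvd_constantCoeff) (hDel : Delbourgo2002.mainTheorem)
    (hGZK : rank_eq_analyticRank_of_analyticRank_le_one) (hmod : hasEntireLFunction_rat)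
    (hmodD : nonempty_modularParametrizationData)
    (hX : ClassX4Gord W p) (hcm : ¬ W.HasCM) (hp5 : 5 ≤ p) (he : semistabilityIndex W p = 2)
    (hsurj : Surj W p) (hr : W.analyticRank = 0) (hna : Delbourgo2002.ReductionNonAnomalous W p)
    (hT : TameBranchRatCharEqAt W p)
    {N : ℕ} [NeZero N] {f : CuspForm (Gamma0 N) 2} {ε : DirichletCharacter ℂ_[p] p} {α : ℚ_[p]}
    {B : PowerSeries ℚ_[p]}
    (hf : IsNewformOf W f) (hε : orderOf ε = tameDefect W p) (hα : ‖α‖ = 1)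
    (hB : IsTameBranchOf f p ε α B) (hcert : ∃ n : ℕ, ‖PowerSeries.coeff n B‖ = 1)
    {q : ℚ} (hq : W.entireLFunction 1 = (q : ℂ) * (W.realPeriodRat : ℂ))
    {z₀ : ℤ_[p]} (h0 : α⁻¹ * (ratPlusSymbol f 0 : ℚ_[p]) = (z₀ : ℚ_[p]) * (q : ℚ_[p])) : BSDp W p :=
  ClassX4Gord.bsdp_rankZero_of_cycLower_of_katoComponent hKa hPal hDel98 hDel hGZK hmod hmodD hX hcm hp5
    he hsurj hr
    (TypeGOrd.cycLowerLeadingTermAt_of_tameBranchRatCharEq_of_unitCoeff W p hX.1.1 hX.1.2.1 hX.2 hT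
      hf hε hα hB hcert hq h0) hna

/-- **X3♯(G-ord), `p ≥ 5`, EVERY defect, `r_an = 0`, non-CM, non-anomalous: the LOWER half from the
tame inputs** through Delbourgo 2002 (`ClassX3Gord.missingLowerBoundAt_rankZero_of_cycLower_of_nonAnomalous`).
[cite: Delbourgo2002, Theorem (A), (B) (p. 40)] [cite: Miller2011LMS, Def. 1.1] -/
theorem ClassX3Gord.missingLowerBoundAt_rankZero_of_tameBranchRatCharEq_of_unitCoeff_of_nonAnomalous
    (hDel : Delbourgo2002.mainTheorem)
    (hGZK : rank_eq_analyticRank_of_analyticRank_le_one) (hmod : hasEntireLFunction_rat)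
    (hp2 : p ≠ 2) (hX : ClassX3Gord W p) (hcm : ¬ W.HasCM) (hp5 : 5 ≤ p) (hr : W.analyticRank = 0)
    (hna : Delbourgo2002.ReductionNonAnomalous W p)
    (hT : TameBranchRatCharEqAt W p)
    {N : ℕ} [NeZero N] {f : CuspForm (Gamma0 N) 2} {ε : DirichletCharacter ℂ_[p] p} {α : ℚ_[p]}
    {B : PowerSeries ℚ_[p]}
    (hf : IsNewformOf W f) (hε : orderOf ε = tameDefect W p) (hα : ‖α‖ = 1)
    (hB : IsTameBranchOf f p ε α B) (hcert : ∃ n : ℕ, ‖PowerSeries.coeff n B‖ = 1)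
    {q : ℚ} (hq : W.entireLFunction 1 = (q : ℂ) * (W.realPeriodRat : ℂ))
    {z₀ : ℤ_[p]} (h0 : α⁻¹ * (ratPlusSymbol f 0 : ℚ_[p]) = (z₀ : ℚ_[p]) * (q : ℚ_[p])) :
    MissingLowerBoundAt W p :=
  ClassX3Gord.missingLowerBoundAt_rankZero_of_cycLower_of_nonAnomalous hDel hGZK hmod hX hcm hp5 hr
    (TypeGOrd.cycLowerLeadingTermAt_of_tameBranchRatCharEq_of_unitCoeff W p hp2 hX.1.2 hX.2 hT
      hf hε hα hB hcert hq h0) hna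

/-- **X3♯(G-ord) ∩ `I₀*` (`e = 2`), `p ≥ 5`, `r_an = 0`, non-CM, non-anomalous: `BSD(E,p)` ⟸ the tame
inputs ALONE** — UPPER half = the Wuthrich-component theorem
(`ClassX3Gord.bsdp_rankZero_of_cycLower_of_wuthrichComponent`). Nothing booked.
[cite: Wuthrich2014, Thm. 16 (p. 397)] [cite: Delbourgo2002, Theorem (A), (B) (p. 40)] -/
theorem ClassX3Gord.bsdp_rankZero_of_tameBranchRatCharEq_of_unitCoeff_of_wuthrichComponent_of_nonAnomalous
    (hWu : Wuthrich2014.charIdeal_dvd_padicLFunctionBranch_component)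
    (hPal : Pal2012.thm32_sqrt_mul_realPeriodRat_twist_eq_of_prime_one_mod_four)
    (hDel98 : Delbourgo1998.prop4_rankZero_pow_dvd_constantCoeff) (hDel : Delbourgo2002.mainTheorem)
    (hGZK : rank_eq_analyticRank_of_analyticRank_le_one) (hmod : hasEntireLFunction_rat)
    (hmodD : nonempty_modularParametrizationData)
    (hp2 : p ≠ 2) (hX : ClassX3Gord W p) (hcm : ¬ W.HasCM) (hp5 : 5 ≤ p)
    (he : semistabilityIndex W p = 2) (hr : W.analyticRank = 0)
    (hna : Delbourgo2002.ReductionNonAnomalous W p)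
    (hT : TameBranchRatCharEqAt W p)
    {N : ℕ} [NeZero N] {f : CuspForm (Gamma0 N) 2} {ε : DirichletCharacter ℂ_[p] p} {α : ℚ_[p]}
    {B : PowerSeries ℚ_[p]}
    (hf : IsNewformOf W f) (hε : orderOf ε = tameDefect W p) (hα : ‖α‖ = 1)
    (hB : IsTameBranchOf f p ε α B) (hcert : ∃ n : ℕ, ‖PowerSeries.coeff n B‖ = 1)
    {q : ℚ} (hq : W.entireLFunction 1 = (q : ℂ) * (W.realPeriodRat : ℂ))
    {z₀ : ℤ_[p]} (h0 : α⁻¹ * (ratPlusSymbol f 0 : ℚ_[p]) = (z₀ : ℚ_[p]) * (q : ℚ_[p])) : BSDp W p :=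
  ClassX3Gord.bsdp_rankZero_of_cycLower_of_wuthrichComponent hWu hPal hDel98 hDel hGZK hmod hmodD hX hcm
    hp5 he hr
    (TypeGOrd.cycLowerLeadingTermAt_of_tameBranchRatCharEq_of_unitCoeff W p hp2 hX.1.2 hX.2 hT
      hf hε hα hB hcert hq h0) hna

end FiveLe

/-! ### §3 `p = 3`: N11's (G-ord)@3 rows over `Delbourgo2002.mainTheorem_three` -/

section Three

variable {W : WeierstrassCurve ℚ} [W.IsElliptic] [W.IsGloballyMinimal]

/-- **X4♯(G-ord) at `3`, `r_an = 0`, non-CM, OFF the anomalous rows: the LOWER half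
`ord₃ #Ш_an(E) ≤ ord₃ #Ш(E)` from the tame inputs at `p = 3`** through `Delbourgo2002.mainTheorem_three`
(`hDel3`; p16's `ClassX4Gord.missingLowerBoundAt_three_rankZero_of_cycLower_of_nonAnomalous`). No
`ExactLeadingTermAt`. [cite: Delbourgo2002, Theorem (A), (B) (p. 40), Hypothesis second bullet (p. 39)]
[cite: Miller2011LMS, Def. 1.1] -/
theorem ClassX4Gord.missingLowerBoundAt_three_rankZero_of_tameBranchRatCharEq_of_unitCoeff_of_nonAnomalous
    [Fact (Nat.Prime 3)] (hDel3 : Delbourgo2002.mainTheorem_three)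
    (hGZK : rank_eq_analyticRank_of_analyticRank_le_one) (hmod : hasEntireLFunction_rat)
    (hX : ClassX4Gord W 3) (hcm : ¬ W.HasCM) (hr : W.analyticRank = 0)
    (hna : Delbourgo2002.ReductionNonAnomalous W 3)
    (hT : TameBranchRatCharEqAt W 3)
    {N : ℕ} [NeZero N] {f : CuspForm (Gamma0 N) 2} {ε : DirichletCharacter ℂ_[3] 3} {α : ℚ_[3]}
    {B : PowerSeries ℚ_[3]}
    (hf : IsNewformOf W f) (hε : orderOf ε = tameDefect W 3) (hα : ‖α‖ = 1)
    (hB : IsTameBranchOf f 3 ε α B) (hcert : ∃ n : ℕ, ‖PowerSeries.coeff n B‖ = 1)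
    {q : ℚ} (hq : W.entireLFunction 1 = (q : ℂ) * (W.realPeriodRat : ℂ))
    {z₀ : ℤ_[3]} (h0 : α⁻¹ * (ratPlusSymbol f 0 : ℚ_[3]) = (z₀ : ℚ_[3]) * (q : ℚ_[3])) :
    MissingLowerBoundAt W 3 :=
  ClassX4Gord.missingLowerBoundAt_three_rankZero_of_cycLower_of_nonAnomalous hDel3 hGZK hmod hX hcm hr hna
    (TypeGOrd.cycLowerLeadingTermAt_of_tameBranchRatCharEq_of_unitCoeff W 3 (by norm_num) hX.1.2.1 hX.2
      hT hf hε hα hB hcert hq h0)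

/-- **X4♯(G-ord) at `3` ∧ `surj(3)`, `r_an = 0`, non-CM, non-anomalous: `BSD(E,3)` ⟸ the tame inputs at
`p = 3` ALONE** — UPPER half = the ω-branch Kato-component chain at `3` (p16's
`ClassX4Gord.bsdp_three_rankZero_of_cycLower_of_nonAnomalous_of_surj`: `hK`, `hDel`, `hmodD`). Nothing
booked. [cite: Kato2004Asterisque, Thm. 17.4 (3) (p. 273)] [cite: Delbourgo2002, Theorem (A), (B) (p. 40)] -/
theorem ClassX4Gord.bsdp_three_rankZero_of_tameBranchRatCharEq_of_unitCoeff_of_nonAnomalous_of_surj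
    [Fact (Nat.Prime 3)] (hDel3 : Delbourgo2002.mainTheorem_three)
    (hK : Kato2004.charIdeal_dvd_padicLFunctionBranch_component_of_surjective)
    (hDel : Delbourgo1998.prop4_rankZero_pow_dvd_constantCoeff)
    (hGZK : rank_eq_analyticRank_of_analyticRank_le_one) (hmod : hasEntireLFunction_rat)
    (hmodD : nonempty_modularParametrizationData)
    (hX : ClassX4Gord W 3) (hcm : ¬ W.HasCM) (hr : W.analyticRank = 0) (hsurj : Surj W 3)
    (hna : Delbourgo2002.ReductionNonAnomalous W 3)
    (hT : TameBranchRatCharEqAt W 3)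
    {N : ℕ} [NeZero N] {f : CuspForm (Gamma0 N) 2} {ε : DirichletCharacter ℂ_[3] 3} {α : ℚ_[3]}
    {B : PowerSeries ℚ_[3]}
    (hf : IsNewformOf W f) (hε : orderOf ε = tameDefect W 3) (hα : ‖α‖ = 1)
    (hB : IsTameBranchOf f 3 ε α B) (hcert : ∃ n : ℕ, ‖PowerSeries.coeff n B‖ = 1)
    {q : ℚ} (hq : W.entireLFunction 1 = (q : ℂ) * (W.realPeriodRat : ℂ))
    {z₀ : ℤ_[3]} (h0 : α⁻¹ * (ratPlusSymbol f 0 : ℚ_[3]) = (z₀ : ℚ_[3]) * (q : ℚ_[3])) : BSDp W 3 :=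
  ClassX4Gord.bsdp_three_rankZero_of_cycLower_of_nonAnomalous_of_surj hDel3 hK hDel hGZK hmod hmodD hX hcm
    hr hsurj hna
    (TypeGOrd.cycLowerLeadingTermAt_of_tameBranchRatCharEq_of_unitCoeff W 3 (by norm_num) hX.1.2.1 hX.2
      hT hf hε hα hB hcert hq h0)

/-- **(G-ord)@3, EVERY row (anomalous included): `#Ш_an = q` with `ord₃ q ≤ ord₃ #Ш(E) + 2` from the
tame inputs at `p = 3`** (slack `ℓ ∣ 9`; p16's `TypeGOrd.padicValRat_shaAn_le_add_two_three_of_cycLower`).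
On these rows the exact alternative is the `K`-side route of `XGordRankZeroCyclotomicThreeLowerFacts.lean`
(different input currency). [cite: Delbourgo2002, Theorem (B) (p. 40), ℓ_p(E) (p. 39)] -/
theorem TypeGOrd.padicValRat_shaAn_le_add_two_three_of_tameBranchRatCharEq_of_unitCoeff
    [Fact (Nat.Prime 3)] (hDel3 : Delbourgo2002.mainTheorem_three)
    (hGZK : rank_eq_analyticRank_of_analyticRank_le_one) (hmod : hasEntireLFunction_rat)
    (hG : TypeGOrd W 3) (hadd : Addv W 3) (hcm : ¬ W.HasCM) (hr : W.analyticRank = 0)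
    (hT : TameBranchRatCharEqAt W 3)
    {N : ℕ} [NeZero N] {f : CuspForm (Gamma0 N) 2} {ε : DirichletCharacter ℂ_[3] 3} {α : ℚ_[3]}
    {B : PowerSeries ℚ_[3]}
    (hf : IsNewformOf W f) (hε : orderOf ε = tameDefect W 3) (hα : ‖α‖ = 1)
    (hB : IsTameBranchOf f 3 ε α B) (hcert : ∃ n : ℕ, ‖PowerSeries.coeff n B‖ = 1)
    {q : ℚ} (hq : W.entireLFunction 1 = (q : ℂ) * (W.realPeriodRat : ℂ))
    {z₀ : ℤ_[3]} (h0 : α⁻¹ * (ratPlusSymbol f 0 : ℚ_[3]) = (z₀ : ℚ_[3]) * (q : ℚ_[3])) :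
    ∃ q : ℚ, shaAn W = (q : ℂ) ∧ padicValRat 3 q ≤ padicValNat 3 W.shaOrder + 2 :=
  TypeGOrd.padicValRat_shaAn_le_add_two_three_of_cycLower hDel3 hGZK hmod hG hadd hcm hr
    (TypeGOrd.cycLowerLeadingTermAt_of_tameBranchRatCharEq_of_unitCoeff W 3 (by norm_num) hadd hG hT
      hf hε hα hB hcert hq h0)

/-- **X3♯(G-ord) at `3`, `r_an = 0`, non-CM, OFF the anomalous rows: the LOWER half from the tame inputs
at `p = 3`** (`ClassX3Gord.missingLowerBoundAt_three_rankZero_of_cycLower_of_nonAnomalous`).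
[cite: Delbourgo2002, Theorem (A), (B) (p. 40)] [cite: Miller2011LMS, Def. 1.1] -/
theorem ClassX3Gord.missingLowerBoundAt_three_rankZero_of_tameBranchRatCharEq_of_unitCoeff_of_nonAnomalous
    [Fact (Nat.Prime 3)] (hDel3 : Delbourgo2002.mainTheorem_three)
    (hGZK : rank_eq_analyticRank_of_analyticRank_le_one) (hmod : hasEntireLFunction_rat)
    (hX : ClassX3Gord W 3) (hcm : ¬ W.HasCM) (hr : W.analyticRank = 0)
    (hna : Delbourgo2002.ReductionNonAnomalous W 3)
    (hT : TameBranchRatCharEqAt W 3)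
    {N : ℕ} [NeZero N] {f : CuspForm (Gamma0 N) 2} {ε : DirichletCharacter ℂ_[3] 3} {α : ℚ_[3]}
    {B : PowerSeries ℚ_[3]}
    (hf : IsNewformOf W f) (hε : orderOf ε = tameDefect W 3) (hα : ‖α‖ = 1)
    (hB : IsTameBranchOf f 3 ε α B) (hcert : ∃ n : ℕ, ‖PowerSeries.coeff n B‖ = 1)
    {q : ℚ} (hq : W.entireLFunction 1 = (q : ℂ) * (W.realPeriodRat : ℂ))
    {z₀ : ℤ_[3]} (h0 : α⁻¹ * (ratPlusSymbol f 0 : ℚ_[3]) = (z₀ : ℚ_[3]) * (q : ℚ_[3])) :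
    MissingLowerBoundAt W 3 :=
  ClassX3Gord.missingLowerBoundAt_three_rankZero_of_cycLower_of_nonAnomalous hDel3 hGZK hmod hX hcm hr hna
    (TypeGOrd.cycLowerLeadingTermAt_of_tameBranchRatCharEq_of_unitCoeff W 3 (by norm_num) hX.1.2 hX.2
      hT hf hε hα hB hcert hq h0)

/-- **X3♯(G-ord) at `3`, `r_an = 0`, non-CM, non-anomalous: `BSD(E,3)` ⟸ the tame inputs at `p = 3`
ALONE** — UPPER half = Wuthrich Thm. 16 on the minus eigenspace at `3`
(`ClassX3Gord.bsdp_three_rankZero_of_cycLower_of_nonAnomalous`: `hW16`, `hDel`, `hmodD`). Nothing booked.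
[cite: Wuthrich2014, Thm. 16 (p. 397)] [cite: Delbourgo2002, Theorem (A), (B) (p. 40)] -/
theorem ClassX3Gord.bsdp_three_rankZero_of_tameBranchRatCharEq_of_unitCoeff_of_nonAnomalous
    [Fact (Nat.Prime 3)] (hDel3 : Delbourgo2002.mainTheorem_three)
    (hW16 : Wuthrich2014.thm16_minusEigenCharIdeal_dvd_cyclotomicThree)
    (hDel : Delbourgo1998.prop4_rankZero_pow_dvd_constantCoeff)
    (hGZK : rank_eq_analyticRank_of_analyticRank_le_one) (hmod : hasEntireLFunction_rat)
    (hmodD : nonempty_modularParametrizationData)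
    (hX : ClassX3Gord W 3) (hcm : ¬ W.HasCM) (hr : W.analyticRank = 0)
    (hna : Delbourgo2002.ReductionNonAnomalous W 3)
    (hT : TameBranchRatCharEqAt W 3)
    {N : ℕ} [NeZero N] {f : CuspForm (Gamma0 N) 2} {ε : DirichletCharacter ℂ_[3] 3} {α : ℚ_[3]}
    {B : PowerSeries ℚ_[3]}
    (hf : IsNewformOf W f) (hε : orderOf ε = tameDefect W 3) (hα : ‖α‖ = 1)
    (hB : IsTameBranchOf f 3 ε α B) (hcert : ∃ n : ℕ, ‖PowerSeries.coeff n B‖ = 1)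
    {q : ℚ} (hq : W.entireLFunction 1 = (q : ℂ) * (W.realPeriodRat : ℂ))
    {z₀ : ℤ_[3]} (h0 : α⁻¹ * (ratPlusSymbol f 0 : ℚ_[3]) = (z₀ : ℚ_[3]) * (q : ℚ_[3])) : BSDp W 3 :=
  ClassX3Gord.bsdp_three_rankZero_of_cycLower_of_nonAnomalous hDel3 hW16 hDel hGZK hmod hmodD hX hcm hr hna
    (TypeGOrd.cycLowerLeadingTermAt_of_tameBranchRatCharEq_of_unitCoeff W 3 (by norm_num) hX.1.2 hX.2
      hT hf hε hα hB hcert hq h0)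

end Three

end Summit.BirchSwinnertonDyer.Rank1Residual.Additive

end
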